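import Summits.Schanuel.Schanuel.Theorems.ZilberEacResidueClassPi
import Summits.Schanuel.Schanuel.Theorems.ZilberEacGraphCurveInstances
import Mathlib.RingTheory.MvPolynomial.IrreducibleQuadratic
import HarnessLib

/-!
# Arbitrary base branches, LXXVII: CONSTANT FIBRES OVER POLYNOMIAL GRAPHS in the oscillatory class —
# `{x₁ = x₀³, y₀ = θ}` is dense for EVERY `θ` (Kronecker–van der Corput + Lindemann)

HONEST FRAMING.  Cell `pub-schanuel` (Zilber's Exponential-Algebraic Closedness, case ladder;
host summit Schanuel), seat 2, gen 32.  Over a polynomial graph `x₁ = p(x₀)` (`deg p = M ≥ 2`,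
leading coefficient `c`) Mantova–Masser's question was answered YES for every surface except the
constant-fibre cylinders `{x₁ = p(x₀), y₀ = θ}` (gen 26, `mmCase_graphBase_complete`), and for
those: YES by growth when `Re(c(2πi)^M) ≠ 0` (gens 9–10), YES off a circle `|θ| = ρ` by the
`τ`-coefficient (gen 29), NO for `{x₁ = x₀²/(2πi), y₀ = 1}` (seat 1, gen 9).  The OSCILLATORY
members — `c(2πi)^M ∈ iℝ`, e.g. `{x₁ = x₀³, y₀ = θ}` with `|θ| = 1`, whose exponential points
`(2πin + iφ, (2πin + iφ)³, θ, e^{(2πin+iφ)³})` all have `|y₁| = 1` — were open since gen 9 ("no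
growth at any order; Weyl equidistribution out of reach", O33 (i′)).  File LXXII's dichotomy needs
only ONE irrational phase coefficient: here `Im(c(2πi)^M)/2π = ±c·2^{M−1}π^{M−1}`, irrational for
rational `c ≠ 0` because `π` is transcendental (Lindemann; file LXXVI).  Hence:
* **`unprojectedDense_graph_constFibre_of_irrational_phase`** — `Im(c(2πi)^M)/2π ∉ ℚ` ⟹
  `{x₁ = p(x₀), y₀ = θ}` dense for every `θ ≠ 0` (`deg p ≥ 1`);
* **`unprojectedDensityQuestion_graph_constFibre_oddDegree`** — `p` of ODD degree `≥ 3` with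
  RATIONAL leading coefficient: case ∧ dense for EVERY `θ ≠ 0`;
* **`unprojectedDensityQuestion_cubicGraph_constFibre`** — `{x₁ = x₀³, y₀ = θ}`, every `θ ≠ 0`
  (`θ = 1` included: O33 (i′) closed).
What remains over graphs: the RESONANT cylinders `c(2πi)^{M−1} ∈ ℚ` (with all lower phase
coefficients), e.g. `x₁ = x₀²/(2πi)` — where density genuinely fails for `y₀ = 1`.  Decided instances
of an OPEN question (Mantova–Masser, PLMS 2024 §1 p. 5); EC(3,2) OPEN; NOT Schanuel's conjecture
(neither used nor implied); EAC ⇏ SC.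
-/

noncomputable section

open Filter Topology Set Complex MvPolynomial
open Literature.NumberTheory.Transcendental Literature.ModelTheory.Zilber
open Literature.ModelTheory.ExponentialFields

set_option linter.dupNamespace false

namespace Summit.Schanuel.Schanuel.Theorems

/-! ## Part A. The constant-fibre polynomial `y₀ − θ` -/

/-- `y₀ − θ` is irreducible in `ℂ[y₀, y₁]` (total degree one, a unit coefficient). [folklore] -/
theorem irreducible_X0_sub_C (θ : ℂ) : Irreducible (X 0 - MvPolynomial.C θ : MvPolynomial (Fin 2) ℂ) := by
  classical
  have hne : (0 : Fin 2 →₀ ℕ) ≠ Finsupp.single 0 1 := (Finsupp.single_ne_zero.2 one_ne_zero).symm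
  have hcoeff : MvPolynomial.coeff (Finsupp.single (0 : Fin 2) 1)
      (X 0 - MvPolynomial.C θ : MvPolynomial (Fin 2) ℂ) = 1 := by
    rw [MvPolynomial.coeff_sub, MvPolynomial.coeff_C, if_neg hne, sub_zero]
    simp
  refine MvPolynomial.irreducible_of_totalDegree_eq_one ?_ ?_
  · refine le_antisymm ((MvPolynomial.totalDegree_sub_C_le _ _).trans
      (by rw [MvPolynomial.totalDegree_X])) ?_
    have hmem : (Finsupp.single (0 : Fin 2) 1) ∈
        (X 0 - MvPolynomial.C θ : MvPolynomial (Fin 2) ℂ).support := by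
      rw [MvPolynomial.mem_support_iff, hcoeff]
      exact one_ne_zero
    have h := MvPolynomial.le_totalDegree hmem
    rwa [Finsupp.sum_single_index rfl] at h
  · intro x hx
    have h := hx (Finsupp.single (0 : Fin 2) 1)
    rw [hcoeff] at h
    exact isUnit_of_dvd_one h

/-! ## Part B. The graph germ at infinity and density from an irrational top phase -/

section Graph

variable (p : Polynomial ℂ)

/-- **Constant fibres over a polynomial graph with an IRRATIONAL top phase: dense.**  `deg p = M ≥ 1`
with leading coefficient `c` and `Im(c(2πi)^M)/2π ∉ ℚ`; `θ ≠ 0`.  The germ `x₀ = 1/s`,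
`x₁ = p(1/s) = U₀(s)s^{-M}` (`U₀(0) = c`), `y₀ = θ` lies on `{x₁ = p(x₀), y₀ = θ}`, and file LXXII
applies with `k = 1`, `z = 2πi`. [cite: MantovaMasser2023, §1 Further remarks, p. 5 (the question,
open in general)] (new) -/
theorem unprojectedDense_graph_constFibre_of_irrational_phase (hd : 1 ≤ p.natDegree)
    (hdir : Irrational ((p.leadingCoeff * (2 * Real.pi * I) ^ p.natDegree).im / (2 * Real.pi)))
    {θ : ℂ} (hθ : θ ≠ 0) :
    UnprojectedDense {w : Fin 2 ⊕ Fin 2 → ℂ | w (Sum.inl 1) = p.eval (w (Sum.inl 0)) ∧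
      MvPolynomial.eval (fun i => w (Sum.inr i)) (X 0 - MvPolynomial.C θ : MvPolynomial (Fin 2) ℂ) = 0} := by
  have hS := isIrreducibleClosed_graphCurveSurface p (irreducible_X0_sub_C θ)
  have hdim := zariskiDim_graphCurveSurface p (irreducible_X0_sub_C θ)
  obtain ⟨U₀, hUan, hU0, hUeval⟩ :=
    exists_polarForm_eval p (U := fun _ : ℂ => (1 : ℂ)) analyticAt_const (k := 1) le_rfl
  rw [one_pow, mul_one] at hU0
  refine unprojectedDense_branch_of_irrational_phase hS (le_of_eq hdim) le_rfl hd
    (ψ := fun _ => θ) analyticAt_const hθ rfl hUan ⟨2 * Real.pi * I, pow_one _, ?_⟩ ?_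
  · rw [hU0]
    exact hdir
  · filter_upwards [self_mem_nhdsWithin] with s (hs : s ≠ 0)
    refine ⟨?_, ?_⟩
    · simp only [Sum.elim_inl, Matrix.cons_val_one, Matrix.cons_val_zero]
      have h := hUeval s hs
      rw [one_mul, one_mul, pow_one] at h
      rw [← inv_pow, pow_one, h]
    · simp [Sum.elim_inr]

/-- **Case ∧ dense** (`deg p ≥ 2`): `{x₁ = p(x₀), y₀ = θ}` is in Mantova–Masser's case and dense
when `Im(c(2πi)^M)/2π ∉ ℚ`. [cite: MantovaMasser2023, §1 Further remarks, p. 5 (the question, open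
in general)] (new) -/
theorem unprojectedDensityQuestion_graph_constFibre_of_irrational_phase (hd : 2 ≤ p.natDegree)
    (hdir : Irrational ((p.leadingCoeff * (2 * Real.pi * I) ^ p.natDegree).im / (2 * Real.pi)))
    {θ : ℂ} (hθ : θ ≠ 0) :
    MMCaseDimPiOneFree {w : Fin 2 ⊕ Fin 2 → ℂ | w (Sum.inl 1) = p.eval (w (Sum.inl 0)) ∧
        w (Sum.inr 0) = θ} ∧
      UnprojectedDense {w : Fin 2 ⊕ Fin 2 → ℂ | w (Sum.inl 1) = p.eval (w (Sum.inl 0)) ∧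
        w (Sum.inr 0) = θ} := by
  have e : {w : Fin 2 ⊕ Fin 2 → ℂ | w (Sum.inl 1) = p.eval (w (Sum.inl 0)) ∧
      MvPolynomial.eval (fun i => w (Sum.inr i)) (X 0 - MvPolynomial.C θ : MvPolynomial (Fin 2) ℂ) = 0}
      = {w : Fin 2 ⊕ Fin 2 → ℂ | w (Sum.inl 1) = p.eval (w (Sum.inl 0)) ∧ w (Sum.inr 0) = θ} := by
    ext w
    simp only [Set.mem_setOf_eq, map_sub, MvPolynomial.eval_X, MvPolynomial.eval_C, sub_eq_zero]
  rw [← e]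
  refine ⟨mmCase_graphCurveSurface p hd (irreducible_X0_sub_C θ)
    ((graphCurveSurface_inter_torusLocus_nonempty_iff p _).2 ⟨![θ, 1], by simpa using hθ, by simp,
      by simp⟩), unprojectedDense_graph_constFibre_of_irrational_phase p (by omega) hdir hθ⟩

/-- **Odd degree, rational leading coefficient: every constant fibre is dense.**  `p` of ODD degree
`M ≥ 3` with `lc(p) = q ∈ ℚ`, `q ≠ 0`: `(2πi)^M = ±(2π)^M i` is purely imaginary (the oscillatory
class) and `Im(q(2πi)^M)/2π = ±q·2^{M−1}π^{M−1}` is irrational (Lindemann), so for every `θ ≠ 0`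
`{x₁ = p(x₀), y₀ = θ}` is in the case AND dense. [cite: MantovaMasser2023, §1 Further remarks,
p. 5 (the question, open in general)] (new) -/
theorem unprojectedDensityQuestion_graph_constFibre_oddDegree (hodd : Odd p.natDegree)
    (h3 : 3 ≤ p.natDegree) {q : ℚ} (hq : q ≠ 0) (hlc : p.leadingCoeff = (q : ℂ)) {θ : ℂ}
    (hθ : θ ≠ 0) :
    MMCaseDimPiOneFree {w : Fin 2 ⊕ Fin 2 → ℂ | w (Sum.inl 1) = p.eval (w (Sum.inl 0)) ∧
        w (Sum.inr 0) = θ} ∧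
      UnprojectedDense {w : Fin 2 ⊕ Fin 2 → ℂ | w (Sum.inl 1) = p.eval (w (Sum.inl 0)) ∧
        w (Sum.inr 0) = θ} := by
  refine unprojectedDensityQuestion_graph_constFibre_of_irrational_phase p (by omega) ?_ hθ
  set M := p.natDegree with hM
  -- `w = (2πi)^M`: `w² = (2πi)^{2M}`, `2M ≡ 2 (mod 4)`, `2M ≠ 2`
  have hw : ((2 * Real.pi * I : ℂ) ^ M) ^ 2 = (2 * Real.pi * I) ^ (2 * M) := by
    rw [← pow_mul, Nat.mul_comm M 2]
  obtain ⟨m, hm⟩ := hodd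
  have hmod : (2 * M) % 4 = 2 := by omega
  have hne : 2 * M ≠ 2 := by omega
  have hirr := irrational_im_div_two_pi_of_sq_eq hw hmod hne
  have e : ((q : ℂ) * (2 * Real.pi * I) ^ M).im / (2 * Real.pi) =
      (q : ℝ) * (((2 * Real.pi * I : ℂ) ^ M).im / (2 * Real.pi)) := by
    rw [show ((q : ℂ)) = ((q : ℝ) : ℂ) by norm_cast, Complex.im_ofReal_mul, mul_div_assoc]
  rw [hlc, e]
  exact hirr.ratCast_mul hq

/-- **`{x₁ = x₀³, y₀ = θ}`: case ∧ dense for EVERY `θ ≠ 0`** — including `|θ| = 1`, where all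
exponential points have `|y₁| = 1` and no growth mechanism applies: the phases
`e^{−8π³in³ + …}` do not accumulate at a finite set because `4π²` is irrational (Lindemann) — the
oscillatory example open since gen 9 (O33 (i′)). [cite: MantovaMasser2023, §1 Further remarks, p. 5
(the question, open in general)] (new) -/
theorem unprojectedDensityQuestion_cubicGraph_constFibre {θ : ℂ} (hθ : θ ≠ 0) :
    MMCaseDimPiOneFree {w : Fin 2 ⊕ Fin 2 → ℂ | w (Sum.inl 1) = w (Sum.inl 0) ^ 3 ∧
        w (Sum.inr 0) = θ} ∧
      UnprojectedDense {w : Fin 2 ⊕ Fin 2 → ℂ | w (Sum.inl 1) = w (Sum.inl 0) ^ 3 ∧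
        w (Sum.inr 0) = θ} := by
  have hdeg : (Polynomial.X ^ 3 : Polynomial ℂ).natDegree = 3 := Polynomial.natDegree_X_pow 3
  have h := unprojectedDensityQuestion_graph_constFibre_oddDegree (Polynomial.X ^ 3)
    (by rw [hdeg]; exact ⟨1, rfl⟩) (by rw [hdeg]) (q := 1) one_ne_zero
    (by rw [Polynomial.leadingCoeff_X_pow]; norm_num) hθ
  simpa only [Polynomial.eval_pow, Polynomial.eval_X] using h

/-- **`{x₁ = x₀³, y₀ = 1}`** — the very surface of O33 (i′) (exponential points
`(2πin, −8π³in³, 1, e^{−8π³in³})`): Zariski dense. [cite: MantovaMasser2023, §1 Further remarks,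
p. 5 (the question, open in general)] (new) -/
theorem unprojectedDensityQuestion_cubicGraph_unitFibre :
    MMCaseDimPiOneFree {w : Fin 2 ⊕ Fin 2 → ℂ | w (Sum.inl 1) = w (Sum.inl 0) ^ 3 ∧
        w (Sum.inr 0) = 1} ∧
      UnprojectedDense {w : Fin 2 ⊕ Fin 2 → ℂ | w (Sum.inl 1) = w (Sum.inl 0) ^ 3 ∧
        w (Sum.inr 0) = 1} :=
  unprojectedDensityQuestion_cubicGraph_constFibre one_ne_zero

/-- **Every odd power**: `{x₁ = x₀^M, y₀ = θ}`, `M` odd `≥ 3`, every `θ ≠ 0`: case ∧ dense.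
[cite: MantovaMasser2023, §1 Further remarks, p. 5 (the question, open in general)] (new) -/
theorem unprojectedDensityQuestion_oddPowerGraph_constFibre {M : ℕ} (hodd : Odd M) (h3 : 3 ≤ M)
    {θ : ℂ} (hθ : θ ≠ 0) :
    MMCaseDimPiOneFree {w : Fin 2 ⊕ Fin 2 → ℂ | w (Sum.inl 1) = w (Sum.inl 0) ^ M ∧
        w (Sum.inr 0) = θ} ∧
      UnprojectedDense {w : Fin 2 ⊕ Fin 2 → ℂ | w (Sum.inl 1) = w (Sum.inl 0) ^ M ∧
        w (Sum.inr 0) = θ} := by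
  have hdeg : (Polynomial.X ^ M : Polynomial ℂ).natDegree = M := Polynomial.natDegree_X_pow M
  have h := unprojectedDensityQuestion_graph_constFibre_oddDegree (Polynomial.X ^ M)
    (by rw [hdeg]; exact hodd) (by rw [hdeg]; exact h3) (q := 1) one_ne_zero
    (by rw [Polynomial.leadingCoeff_X_pow]; norm_num) hθ
  simpa only [Polynomial.eval_pow, Polynomial.eval_X] using h

end Graph

end Summit.Schanuel.Schanuel.Theorems

end
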